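import Summits.ValiantsHypothesis.ValiantsHypothesis.Theses.DivisionGap
import Summits.ValiantsHypothesis.ValiantsHypothesis.Theorems.DivisionGapZeroOneTransferStubMmOfUniform
import Summits.ValiantsHypothesis.ValiantsHypothesis.Theorems.DivisionGapZeroOneTransferStubUniformOfMm

/-!
# Crux `DivisionGap.ZeroOneTransfer` (stmt-ValiantsHypothesis-5066) — UNIFORMITY of the uncharged
child `MonotoneMultiples` (line `charged-uncharged`, Part C′ of lead c11: composition of the landed
stubs `uniformOfMm` p152548 and `mmOfUniform` p152190)

The crux splits exactly as `MonotoneMultiples ∧ CofactorCharging` (tree glue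
`zeroOneTransfer_of_split`, p137357), and the planner's intended route split files MM — "every
0/1-coefficient `VP_ℂ` family has, for some `c` and all `n`, a nonzero nonnegative multiple
`f_n · h` of monotone complexity `≤ 2^((log₂ n + c)^c)`, the cofactor `h` NOT charged" — as a child
item.  Like the crux itself (`zeroOneTransfer_iff_uniform`, p151546), MM is equivalent to a bound
UNIFORM in the `VP` data: for every exponent `e` ONE constant `c` serving every level `n`, every
finite variable type of size `≤ n^e + e` and every 0/1 polynomial of total degree and
`ℂ`-complexity `≤ n^e + e` (`monotoneMultiples_iff_uniform`).  Same finiteness/diagonal argument;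
the certificate `h = 1` again bounds every level.  Statements inline (the child has no named
`def` in the tree yet; `IsVPFamily` is written without the redundant `(k := ℂ)`).  No `def` is
declared. [folklore]
-/

-- `Summit.ValiantsHypothesis.ValiantsHypothesis.…`: mandated single-conjunct layout (Sub = Summit).
set_option linter.dupNamespace false

namespace Summit.ValiantsHypothesis.ValiantsHypothesis.Theorems.DivisionGapZeroOneTransfer

/-- **UNIFORMITY of `MonotoneMultiples`** (the uncharged child of the crux `ZeroOneTransfer`):
MM is equivalent to its uniform form — one constant per exponent `e` bounding the number of
variables, the degree and the `ℂ`-complexity by `n^e + e`.  Composition of the registered stubs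
`uniformOfMm` (finiteness + diagonal) and `mmOfUniform` (bookkeeping). [folklore] -/
theorem monotoneMultiples_iff_uniform :
    (∀ (σ : ℕ → Type) [∀ n, Fintype (σ n)] (f : ∀ n, MvPolynomial (σ n) NNReal), (∀ n m, MvPolynomial.coeff m (f n) = 0 ∨ MvPolynomial.coeff m (f n) = 1) → Literature.Computability.AlgebraicComplexity.IsVPFamily (fun n => MvPolynomial.map (Complex.ofRealHom.comp NNReal.toRealHom) (f n)) → ∃ c : ℕ, ∀ n, ∃ h : MvPolynomial (σ n) NNReal, h ≠ 0 ∧ Literature.Computability.AlgebraicComplexity.complexity (f n * h) ≤ 2 ^ ((Nat.log 2 n + c) ^ c)) ↔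
    (∀ e : ℕ, ∃ c : ℕ, ∀ (n : ℕ) (τ : Type) [Fintype τ] (f : MvPolynomial τ NNReal), (∀ m, MvPolynomial.coeff m f = 0 ∨ MvPolynomial.coeff m f = 1) → Fintype.card τ ≤ n ^ e + e → f.totalDegree ≤ n ^ e + e → Literature.Computability.AlgebraicComplexity.complexity (MvPolynomial.map (Complex.ofRealHom.comp NNReal.toRealHom) f) ≤ n ^ e + e → ∃ h : MvPolynomial τ NNReal, h ≠ 0 ∧ Literature.Computability.AlgebraicComplexity.complexity (f * h) ≤ 2 ^ ((Nat.log 2 n + c) ^ c)) :=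
  ⟨uniformOfMm, mmOfUniform⟩

end Summit.ValiantsHypothesis.ValiantsHypothesis.Theorems.DivisionGapZeroOneTransfer
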